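import Summits.ValiantsHypothesis.ValiantsHypothesis.Theorems.SymPencilPerFourTwoRowsPerm
import Summits.ValiantsHypothesis.ValiantsHypothesis.Theorems.SymPencilPerFourHessianRankThreeProp

/-!
# Route `SymPencil` — Hessian rank `≤ 5` on a singular subspace: a rank-`3` row with a zero cell
# (Case B3 of Task T1 of `Cruxes/SdcSuperquadratic/NEXT-RUNG-23.md`;
# `--supports` stmt-ValiantsHypothesis-5674 `SdcSuperquadratic`)

Setting: `W` a subspace of `4 × 4` matrices on which all `3 × 3` subpermanents vanish (H3) and
with the swapped property with `< 6` squares (`rank (Hess per_4) ≤ 5` on `W`).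

**Case B3** (`finrank_le_six_of_zero_cell`).  Suppose the cell `(a, m₁)` vanishes identically on
`W` while row `a` realises every vector `v` with `v_{m₁} = 0` (row `a` has rank `3`).  Then
`dim W ≤ 6`.

Proof.  (1) Column partners of `m₁` for the pairs `(a, b)`: `x_{ac} x_{b m₁} ≡ 0` with `x_{ac} ≢ 0`,
so the whole column `m₁` vanishes on `W`.  (2) H3 on rows `(a, b, c)` and columns `(k, j, l)`
against an element with row `a = e_k`, degree `2` in `t`: on `W₀ = W ∩ {row a = 0}` all `2 × 2`
subpermanents of the rows `≠ a` (columns `≠ m₁`) vanish.  (3) Row partners ((CP'),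
`SymPencilPerFourHessianColControl`) of the column pairs `{j, l} ⊆ {m₁}ᶜ` for row `a`, with the
control lemma: each such pair kills the two cells `(c_{jl}, j), (c_{jl}, l)` on `W₀` for some row
`c_{jl} ≠ a`.  (4) The three killed rows are pairwise distinct (three surviving cells), or two
coincide (four surviving cells, two of which have identically vanishing product with a third — a
factor vanishes), or all coincide (`W₀` lives in two rows: `SymPencilPerFourTwoRowsPerm`); in every
case `dim W₀ ≤ 3`, and `dim W = 3 + dim W₀ ≤ 6`.

Honest framing: a lemma towards `sdc(per_4) ≥ 25` (Cases A, B1, B2 landed; Case C open); nothing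
here changes `sdc(per_4) ≥ 23`; the crux stays open; `VP ≠ VNP` is not moved. [folklore]
-/

noncomputable section

-- single-conjunct layout: Sub = Summit, duplicated namespace component intended
set_option linter.dupNamespace false

namespace Summit.ValiantsHypothesis.ValiantsHypothesis.Theorems.SymPencilPerFourHessianRankThreeZero

open Matrix MvPolynomial Finset Module
open Literature.Computability.AlgebraicComplexity
open Literature.Computability.AlgebraicComplexity.AlperBogartVelasco
open Summit.ValiantsHypothesis.ValiantsHypothesis.Theorems.SymPencilPerFourHessianMinors
open Summit.ValiantsHypothesis.ValiantsHypothesis.Theorems.SymPencilPerFourHessianRowControl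
open Summit.ValiantsHypothesis.ValiantsHypothesis.Theorems.SymPencilPerFourHessianColControl
open Summit.ValiantsHypothesis.ValiantsHypothesis.Theorems.SymPencilPerFourHessianRankThreeProp
open Summit.ValiantsHypothesis.ValiantsHypothesis.Theorems.SymPencilPerFourTwoRowsPerm

variable {K : Type*} [Field K]

/-! ### Small combinatorics of `Fin 4` -/

/-- The two rows other than `a ≠ r`. [folklore] -/
theorem exists_other_two (a r : Fin 4) (h : a ≠ r) :
    ∃ r' r'' : Fin 4, r' ≠ r'' ∧ r' ≠ a ∧ r' ≠ r ∧ r'' ≠ a ∧ r'' ≠ r ∧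
      ∀ i : Fin 4, i = a ∨ i = r ∨ i = r' ∨ i = r'' := by
  revert a r; decide

/-- The fourth element. [folklore] -/
theorem exists_fourth (a b c : Fin 4) : ∃ d : Fin 4, d ≠ a ∧ d ≠ b ∧ d ≠ c := by
  revert a b c; decide

/-- Four pairwise distinct elements exhaust `Fin 4`. [folklore] -/
theorem eq_or_of_four (a b c d : Fin 4) (hab : a ≠ b) (hac : a ≠ c) (had : a ≠ d) (hbc : b ≠ c)
    (hbd : b ≠ d) (hcd : c ≠ d) (e : Fin 4) : e = a ∨ e = b ∨ e = c ∨ e = d := by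
  revert a b c d e; decide

/-! ### The surviving-cells patterns on `W₀` -/

/-- Pattern "two killed rows coincide": on `U`, rows `a` and `r` vanish, column `m₁` vanishes,
row `r'` vanishes at `jβ, jγ`, and the `2 × 2` subpermanents of rows `r', r''` vanish; then
`dim U ≤ 3`. [folklore] -/
theorem finrank_le_three_pattern_two [CharZero K] (U : Submodule K (Fin 4 × Fin 4 → K))
    (a r r' r'' m₁ jα jβ jγ : Fin 4)
    (hrows : ∀ i : Fin 4, i = a ∨ i = r ∨ i = r' ∨ i = r'')
    (hcols : ∀ j : Fin 4, j ≠ m₁ → j = jα ∨ j = jβ ∨ j = jγ) (hαβ : jα ≠ jβ) (hαγ : jα ≠ jγ)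
    (ha : ∀ x ∈ U, ∀ j, x (a, j) = 0) (hr : ∀ x ∈ U, ∀ j, x (r, j) = 0)
    (hm : ∀ x ∈ U, ∀ i, x (i, m₁) = 0)
    (hβ : ∀ x ∈ U, x (r', jβ) = 0) (hγ : ∀ x ∈ U, x (r', jγ) = 0)
    (hperm : ∀ x ∈ U, ∀ j l : Fin 4, j ≠ l → x (r', j) * x (r'', l) + x (r', l) * x (r'', j) = 0) :
    finrank K U ≤ 3 := by
  -- `x_{r' jα} x_{r'' jβ} ≡ 0` and `x_{r' jα} x_{r'' jγ} ≡ 0` on `U`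
  have pβ : ∀ x ∈ U, x (r', jα) * x (r'', jβ) = 0 := fun x hx => by
    have h := hperm x hx jα jβ hαβ
    rwa [hβ x hx, zero_mul, add_zero] at h
  have pγ : ∀ x ∈ U, x (r', jα) * x (r'', jγ) = 0 := fun x hx => by
    have h := hperm x hx jα jγ hαγ
    rwa [hγ x hx, zero_mul, add_zero] at h
  -- every cell outside `(r', jα), (r'', jα), (r'', jβ), (r'', jγ)` vanishes on `U`
  have hother : ∀ x ∈ U, x (r', jα) = 0 → x (r'', jα) = 0 → x (r'', jβ) = 0 → x (r'', jγ) = 0 →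
      x = 0 := by
    intro x hx h1 h2 h3 h4
    funext p
    obtain ⟨i, j⟩ := p
    rw [Pi.zero_apply]
    by_cases hjm : j = m₁
    · rw [hjm]; exact hm x hx i
    rcases hrows i with hi | hi | hi | hi <;> rw [hi]
    · exact ha x hx j
    · exact hr x hx j
    · rcases hcols j hjm with hj | hj | hj <;> rw [hj]
      · exact h1
      · exact hβ x hx
      · exact hγ x hx
    · rcases hcols j hjm with hj | hj | hj <;> rw [hj]
      · exact h2
      · exact h3
      · exact h4
  rcases forall_eq_zero_or_of_mul₂ U (linePoly_cell (r', jα)) (linePoly_cell (r'', jβ)) pβ with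
    hA | hB
  · -- `x_{r' jα} ≡ 0`: `U` lives in row `r''`
    exact finrank_le_three_of_three_cells U (r'', jα) (r'', jβ) (r'', jγ)
      fun x hx h2 h3 h4 => hother x hx (hA x hx) h2 h3 h4
  · rcases forall_eq_zero_or_of_mul₂ U (linePoly_cell (r', jα)) (linePoly_cell (r'', jγ)) pγ with
      hA' | hC
    · exact finrank_le_three_of_three_cells U (r'', jα) (r'', jβ) (r'', jγ)
        fun x hx h2 h3 h4 => hother x hx (hA' x hx) h2 h3 h4
    · exact finrank_le_three_of_three_cells U (r', jα) (r'', jα) (r'', jα)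
        fun x hx h1 h2 _ => hother x hx h1 h2 (hB x hx) (hC x hx)

/-! ### Case B3 -/

set_option maxHeartbeats 400000 in
/-- **Case B3: a rank-`3` row with a zero cell forces `dim W ≤ 6`.**  See the module docstring.
[folklore] -/
theorem finrank_le_six_of_zero_cell [CharZero K] {ι : Type*} [Fintype ι]
    (hι : Fintype.card ι < 6) (W : Submodule K (Fin 4 × Fin 4 → K))
    (hW3 : ∀ x ∈ W, ∀ (r c : Fin 3 → Fin 4), Function.Injective r → Function.Injective c →
      ((Matrix.of fun i j => x (i, j)).submatrix r c).permanent = 0)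
    (hW : ∀ y ∈ W, ∃ (c : ι → K) (Λ : ι → ((Fin 4 × Fin 4 → K) →ₗ[K] K)),
      ∀ u : Fin 4 × Fin 4 → K, ∃ e₀ e₁ : K, ∀ s : K,
        eval (u + s • y) (perPoly (Fin 4) K) = e₀ + s * e₁ + s ^ 2 * ∑ k, c k * (Λ k u) ^ 2)
    (a m₁ : Fin 4) (hzero : ∀ x ∈ W, x (a, m₁) = 0)
    (hreal : ∀ v : Fin 4 → K, v m₁ = 0 → ∃ z ∈ W, ∀ j, z (a, j) = v j) :
    finrank K W ≤ 6 := by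
  classical
  -- (0) unit rows `e_j` in row `a`, `j ≠ m₁`
  have hunit : ∀ j, j ≠ m₁ → ∃ z ∈ W, ∀ j', z (a, j') = (Pi.single j (1 : K) : Fin 4 → K) j' :=
    fun j hj => hreal (Pi.single j 1) (Pi.single_eq_of_ne (Ne.symm hj) _)
  -- (1) the column `m₁` vanishes on `W`
  have hcol : ∀ x ∈ W, ∀ b, x (b, m₁) = 0 := by
    intro x hx b
    by_cases hba : b = a
    · rw [hba]; exact hzero x hx
    obtain ⟨c, hcm, hq⟩ := exists_perm_col_vanish_of_sum_sq_swap hι W hW a b m₁ (Ne.symm hba)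
    have hprod : ∀ y ∈ W, y (a, c) * y (b, m₁) = 0 := fun y hy => by
      have h := hq y hy
      rwa [hzero y hy, zero_mul, add_zero] at h
    rcases forall_eq_zero_or_of_mul₂ W (linePoly_cell (a, c)) (linePoly_cell (b, m₁)) hprod with
      h | h
    · obtain ⟨z, hz, hzv⟩ := hunit c hcm
      have := h z hz
      rw [hzv, Pi.single_eq_same] at this
      exact absurd this one_ne_zero
    · exact h x hx
  -- (2) on `W₀`: all `2 × 2` subpermanents of rows `≠ a` vanish
  have hperm : ∀ x ∈ W, (∀ j, x (a, j) = 0) → ∀ b c : Fin 4, b ≠ a → c ≠ a → b ≠ c →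
      ∀ j l : Fin 4, j ≠ l → x (b, j) * x (c, l) + x (b, l) * x (c, j) = 0 := by
    intro x hx hxa b c hba hca hbc j l hjl
    by_cases hjm : j = m₁
    · rw [hjm, hcol x hx c, hcol x hx b, mul_zero, zero_mul, add_zero]
    by_cases hlm : l = m₁
    · rw [hlm, hcol x hx c, hcol x hx b, mul_zero, zero_mul, add_zero]
    obtain ⟨k, hkm, hkj, hkl⟩ := exists_fourth m₁ j l
    obtain ⟨z, hz, hzv⟩ := hunit k hkm
    have hzk : z (a, k) = 1 := by rw [hzv, Pi.single_eq_same]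
    have hzj : z (a, j) = 0 := by rw [hzv, Pi.single_eq_of_ne (Ne.symm hkj)]
    have hzl : z (a, l) = 0 := by rw [hzv, Pi.single_eq_of_ne (Ne.symm hkl)]
    have hinjr : Function.Injective ![a, b, c] := by
      intro i i' h
      fin_cases i <;> fin_cases i' <;> simp_all [eq_comm]
    have hinjc : Function.Injective ![k, j, l] := by
      intro i i' h
      fin_cases i <;> fin_cases i' <;> simp_all [eq_comm]
    have P : ∀ t : K, (z (b, j) + t * x (b, j)) * (z (c, l) + t * x (c, l)) +
        (z (b, l) + t * x (b, l)) * (z (c, j) + t * x (c, j)) = 0 := by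
      intro t
      have h := hW3 (z + t • x) (W.add_mem hz (W.smul_mem t hx)) ![a, b, c] ![k, j, l] hinjr hinjc
      rw [Matrix.permanent_fin_three_row] at h
      simp only [Matrix.submatrix_apply, Matrix.of_apply, Matrix.cons_val_zero, Matrix.cons_val_one,
        Matrix.cons_val, Pi.add_apply, Pi.smul_apply, smul_eq_mul, hzk, hzj, hzl, hxa,
        mul_zero, add_zero, one_mul, zero_mul] at h
      linear_combination h
    have h0 := P 0
    have h1 := P 1
    have h2 := P (-1)
    have h3 : (2 : K) * (x (b, j) * x (c, l) + x (b, l) * x (c, j)) = 0 := by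
      linear_combination h1 + h2 - 2 * h0
    exact (mul_eq_zero.1 h3).resolve_left two_ne_zero
  -- (3) row partners of the column pairs for row `a`, and control: killed cells on `W₀`
  have hkill : ∀ j l : Fin 4, j ≠ l → j ≠ m₁ → l ≠ m₁ → ∃ c : Fin 4, c ≠ a ∧
      ∀ x ∈ W, (∀ j', x (a, j') = 0) → x (c, j) = 0 ∧ x (c, l) = 0 := by
    intro j l hjl hjm hlm
    obtain ⟨c, hca, hq⟩ := exists_perm_row_vanish_of_sum_sq_swap hι W hW j l a hjl
    refine ⟨c, hca, fun x hx hxa => ?_⟩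
    have hq' : ∀ y ∈ W, y (a, l) * y (c, j) + y (a, j) * y (c, l) = 0 := fun y hy => by
      have h := hq y hy; linear_combination h
    have h10 : ∃ z ∈ W, z (a, j) = 1 ∧ z (a, l) = 0 := by
      obtain ⟨z, hz, hzv⟩ := hunit j hjm
      exact ⟨z, hz, by rw [hzv, Pi.single_eq_same], by rw [hzv, Pi.single_eq_of_ne (Ne.symm hjl)]⟩
    have h01 : ∃ z ∈ W, z (a, j) = 0 ∧ z (a, l) = 1 := by
      obtain ⟨z, hz, hzv⟩ := hunit l hlm
      exact ⟨z, hz, by rw [hzv, Pi.single_eq_of_ne hjl], by rw [hzv, Pi.single_eq_same]⟩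
    exact cell_eq_zero_of_perm_vanish W hq' h10 h01 hx (hxa j) (hxa l)
  -- (4) `W₀ = W ∩ {row a = 0}` has dimension `≤ 3`
  let ρ : (Fin 4 × Fin 4 → K) →ₗ[K] (Fin 4 → K) := LinearMap.funLeft K K fun j : Fin 4 => (a, j)
  have hρ : ∀ x j, ρ x j = x (a, j) := fun _ _ => rfl
  set W₀ : Submodule K (Fin 4 × Fin 4 → K) := W ⊓ LinearMap.ker ρ with hW₀
  have memW₀ : ∀ x, x ∈ W₀ ↔ x ∈ W ∧ ∀ j, x (a, j) = 0 := fun x => by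
    rw [hW₀, Submodule.mem_inf, LinearMap.mem_ker]
    exact ⟨fun h => ⟨h.1, fun j => by have := congr_fun h.2 j; rwa [hρ] at this⟩,
      fun h => ⟨h.1, funext fun j => h.2 j⟩⟩
  set τ : Equiv.Perm (Fin 4) := Equiv.swap 3 m₁ with hτ
  have hτne : ∀ i : Fin 4, i ≠ 3 → τ i ≠ m₁ := fun i hi => swap_ne m₁ i hi
  have t0 := hτne 0 (by decide); have t1 := hτne 1 (by decide); have t2 := hτne 2 (by decide)
  have n01 : τ 0 ≠ τ 1 := fun h => by have := τ.injective h; exact absurd this (by decide)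
  have n02 : τ 0 ≠ τ 2 := fun h => by have := τ.injective h; exact absurd this (by decide)
  have n12 : τ 1 ≠ τ 2 := fun h => by have := τ.injective h; exact absurd this (by decide)
  have hcols : ∀ j : Fin 4, j ≠ m₁ → j = τ 0 ∨ j = τ 1 ∨ j = τ 2 := fun j hj =>
    eq_swap_of_ne m₁ j hj
  obtain ⟨c₀₁, hc₀₁a, k₀₁⟩ := hkill (τ 0) (τ 1) n01 t0 t1
  obtain ⟨c₀₂, hc₀₂a, k₀₂⟩ := hkill (τ 0) (τ 2) n02 t0 t2
  obtain ⟨c₁₂, hc₁₂a, k₁₂⟩ := hkill (τ 1) (τ 2) n12 t1 t2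
  -- basic facts on `W₀`
  have W₀a : ∀ x ∈ W₀, ∀ j, x (a, j) = 0 := fun x hx => ((memW₀ x).1 hx).2
  have W₀W : ∀ x ∈ W₀, x ∈ W := fun x hx => ((memW₀ x).1 hx).1
  have W₀m : ∀ x ∈ W₀, ∀ i, x (i, m₁) = 0 := fun x hx i => hcol x (W₀W x hx) i
  have W₀perm : ∀ b c : Fin 4, b ≠ a → c ≠ a → b ≠ c → ∀ x ∈ W₀, ∀ j l : Fin 4, j ≠ l →
      x (b, j) * x (c, l) + x (b, l) * x (c, j) = 0 := fun b c hba hca hbc x hx j l hjl =>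
    hperm x (W₀W x hx) (W₀a x hx) b c hba hca hbc j l hjl
  have K₀₁ : ∀ x ∈ W₀, x (c₀₁, τ 0) = 0 ∧ x (c₀₁, τ 1) = 0 := fun x hx =>
    k₀₁ x (W₀W x hx) (W₀a x hx)
  have K₀₂ : ∀ x ∈ W₀, x (c₀₂, τ 0) = 0 ∧ x (c₀₂, τ 2) = 0 := fun x hx =>
    k₀₂ x (W₀W x hx) (W₀a x hx)
  have K₁₂ : ∀ x ∈ W₀, x (c₁₂, τ 1) = 0 ∧ x (c₁₂, τ 2) = 0 := fun x hx =>
    k₁₂ x (W₀W x hx) (W₀a x hx)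
  -- a row killed on all three columns vanishes on `W₀`
  have rowzero : ∀ r, (∀ x ∈ W₀, x (r, τ 0) = 0 ∧ x (r, τ 1) = 0 ∧ x (r, τ 2) = 0) →
      ∀ x ∈ W₀, ∀ j, x (r, j) = 0 := by
    intro r h x hx j
    by_cases hjm : j = m₁
    · rw [hjm]; exact W₀m x hx r
    rcases hcols j hjm with hj | hj | hj <;> rw [hj]
    · exact (h x hx).1
    · exact (h x hx).2.1
    · exact (h x hx).2.2
  have hW₀le : finrank K W₀ ≤ 3 := by
    by_cases h12 : c₀₁ = c₀₂
    · by_cases h13 : c₀₁ = c₁₂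
      · -- all three coincide: `W₀` lives in the two other rows
        have hr : ∀ x ∈ W₀, ∀ j, x (c₀₁, j) = 0 := rowzero c₀₁ fun x hx =>
          ⟨(K₀₁ x hx).1, (K₀₁ x hx).2, by rw [h13]; exact (K₁₂ x hx).2⟩
        obtain ⟨r', r'', hr'r'', hr'a, hr'r, hr''a, hr''r, hrows⟩ := exists_other_two a c₀₁ hc₀₁a.symm
        refine finrank_le_three_of_two_rows_perm W₀ r' r'' m₁ (fun x hx p hp => ?_)
          (W₀perm r' r'' hr'a hr''a hr'r'')
        rcases hp with ⟨h1, h2⟩ | h3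
        · rcases hrows p.1 with h | h | h | h
          · have := W₀a x hx p.2; rwa [← h] at this
          · have := hr x hx p.2; rwa [← h] at this
          · exact absurd h h1
          · exact absurd h h2
        · have := W₀m x hx p.1; rwa [← h3] at this
      · -- `c₀₁ = c₀₂ ≠ c₁₂`: row `c₀₁` dies; row `c₁₂` keeps column `τ 0`
        have hr : ∀ x ∈ W₀, ∀ j, x (c₀₁, j) = 0 := rowzero c₀₁ fun x hx =>
          ⟨(K₀₁ x hx).1, (K₀₁ x hx).2, by rw [h12]; exact (K₀₂ x hx).2⟩
        obtain ⟨r', r'', hr'r'', hr'a, hr'r, hr''a, hr''r, hrows⟩ := exists_other_two a c₀₁ hc₀₁a.symm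
        -- `c₁₂` is `r'` or `r''`
        have hc : c₁₂ = r' ∨ c₁₂ = r'' := by
          rcases hrows c₁₂ with h | h | h | h
          · exact absurd h hc₁₂a
          · exact absurd h.symm h13
          · exact Or.inl h
          · exact Or.inr h
        rcases hc with hc | hc
        · exact finrank_le_three_pattern_two W₀ a c₀₁ r' r'' m₁ (τ 0) (τ 1) (τ 2) hrows hcols n01 n02
            W₀a hr W₀m (fun x hx => by rw [← hc]; exact (K₁₂ x hx).1)
            (fun x hx => by rw [← hc]; exact (K₁₂ x hx).2) (W₀perm r' r'' hr'a hr''a hr'r'')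
        · have hrows' : ∀ i : Fin 4, i = a ∨ i = c₀₁ ∨ i = r'' ∨ i = r' := fun i => by
            rcases hrows i with h | h | h | h
            · exact Or.inl h
            · exact Or.inr (Or.inl h)
            · exact Or.inr (Or.inr (Or.inr h))
            · exact Or.inr (Or.inr (Or.inl h))
          exact finrank_le_three_pattern_two W₀ a c₀₁ r'' r' m₁ (τ 0) (τ 1) (τ 2) hrows' hcols n01
            n02 W₀a hr W₀m (fun x hx => by rw [← hc]; exact (K₁₂ x hx).1)
            (fun x hx => by rw [← hc]; exact (K₁₂ x hx).2) (W₀perm r'' r' hr''a hr'a hr'r''.symm)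
    · by_cases h13 : c₀₁ = c₁₂
      · -- `c₀₁ = c₁₂ ≠ c₀₂`: row `c₀₁` dies; row `c₀₂` keeps column `τ 1`
        have hr : ∀ x ∈ W₀, ∀ j, x (c₀₁, j) = 0 := rowzero c₀₁ fun x hx =>
          ⟨(K₀₁ x hx).1, (K₀₁ x hx).2, by rw [h13]; exact (K₁₂ x hx).2⟩
        obtain ⟨r', r'', hr'r'', hr'a, hr'r, hr''a, hr''r, hrows⟩ := exists_other_two a c₀₁ hc₀₁a.symm
        have hcols' : ∀ j : Fin 4, j ≠ m₁ → j = τ 1 ∨ j = τ 0 ∨ j = τ 2 := fun j hj => by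
          rcases hcols j hj with h | h | h
          · exact Or.inr (Or.inl h)
          · exact Or.inl h
          · exact Or.inr (Or.inr h)
        have hc : c₀₂ = r' ∨ c₀₂ = r'' := by
          rcases hrows c₀₂ with h | h | h | h
          · exact absurd h hc₀₂a
          · exact absurd h.symm h12
          · exact Or.inl h
          · exact Or.inr h
        rcases hc with hc | hc
        · exact finrank_le_three_pattern_two W₀ a c₀₁ r' r'' m₁ (τ 1) (τ 0) (τ 2) hrows hcols'
            n01.symm n12 W₀a hr W₀m (fun x hx => by rw [← hc]; exact (K₀₂ x hx).1)
            (fun x hx => by rw [← hc]; exact (K₀₂ x hx).2) (W₀perm r' r'' hr'a hr''a hr'r'')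
        · have hrows' : ∀ i : Fin 4, i = a ∨ i = c₀₁ ∨ i = r'' ∨ i = r' := fun i => by
            rcases hrows i with h | h | h | h
            · exact Or.inl h
            · exact Or.inr (Or.inl h)
            · exact Or.inr (Or.inr (Or.inr h))
            · exact Or.inr (Or.inr (Or.inl h))
          exact finrank_le_three_pattern_two W₀ a c₀₁ r'' r' m₁ (τ 1) (τ 0) (τ 2) hrows' hcols'
            n01.symm n12 W₀a hr W₀m (fun x hx => by rw [← hc]; exact (K₀₂ x hx).1)
            (fun x hx => by rw [← hc]; exact (K₀₂ x hx).2) (W₀perm r'' r' hr''a hr'a hr'r''.symm)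
      · by_cases h23 : c₀₂ = c₁₂
        · -- `c₀₂ = c₁₂ ≠ c₀₁`: row `c₀₂` dies; row `c₀₁` keeps column `τ 2`
          have hr : ∀ x ∈ W₀, ∀ j, x (c₀₂, j) = 0 := rowzero c₀₂ fun x hx =>
            ⟨(K₀₂ x hx).1, by rw [h23]; exact (K₁₂ x hx).1, (K₀₂ x hx).2⟩
          obtain ⟨r', r'', hr'r'', hr'a, hr'r, hr''a, hr''r, hrows⟩ := exists_other_two a c₀₂ hc₀₂a.symm
          have hcols' : ∀ j : Fin 4, j ≠ m₁ → j = τ 2 ∨ j = τ 0 ∨ j = τ 1 := fun j hj => by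
            rcases hcols j hj with h | h | h
            · exact Or.inr (Or.inl h)
            · exact Or.inr (Or.inr h)
            · exact Or.inl h
          have hc : c₀₁ = r' ∨ c₀₁ = r'' := by
            rcases hrows c₀₁ with h | h | h | h
            · exact absurd h hc₀₁a
            · exact absurd h h12
            · exact Or.inl h
            · exact Or.inr h
          rcases hc with hc | hc
          · exact finrank_le_three_pattern_two W₀ a c₀₂ r' r'' m₁ (τ 2) (τ 0) (τ 1) hrows hcols'
              n02.symm n12.symm W₀a hr W₀m (fun x hx => by rw [← hc]; exact (K₀₁ x hx).1)
              (fun x hx => by rw [← hc]; exact (K₀₁ x hx).2) (W₀perm r' r'' hr'a hr''a hr'r'')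
          · have hrows' : ∀ i : Fin 4, i = a ∨ i = c₀₂ ∨ i = r'' ∨ i = r' := fun i => by
              rcases hrows i with h | h | h | h
              · exact Or.inl h
              · exact Or.inr (Or.inl h)
              · exact Or.inr (Or.inr (Or.inr h))
              · exact Or.inr (Or.inr (Or.inl h))
            exact finrank_le_three_pattern_two W₀ a c₀₂ r'' r' m₁ (τ 2) (τ 0) (τ 1) hrows' hcols'
              n02.symm n12.symm W₀a hr W₀m (fun x hx => by rw [← hc]; exact (K₀₁ x hx).1)
              (fun x hx => by rw [← hc]; exact (K₀₁ x hx).2) (W₀perm r'' r' hr''a hr'a hr'r''.symm)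
        · -- all distinct: three surviving cells `(c₀₁, τ 2), (c₀₂, τ 1), (c₁₂, τ 0)`
          refine finrank_le_three_of_three_cells W₀ (c₀₁, τ 2) (c₀₂, τ 1) (c₁₂, τ 0)
            fun x hx h1 h2 h3 => ?_
          funext p
          obtain ⟨i, j⟩ := p
          rw [Pi.zero_apply]
          by_cases hjm : j = m₁
          · rw [hjm]; exact W₀m x hx i
          rcases eq_or_of_four a c₀₁ c₀₂ c₁₂ hc₀₁a.symm hc₀₂a.symm hc₁₂a.symm h12 h13 h23 i with
            hi | hi | hi | hi <;> rw [hi]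
          · exact W₀a x hx j
          · rcases hcols j hjm with hj | hj | hj <;> rw [hj]
            · exact (K₀₁ x hx).1
            · exact (K₀₁ x hx).2
            · exact h1
          · rcases hcols j hjm with hj | hj | hj <;> rw [hj]
            · exact (K₀₂ x hx).1
            · exact h2
            · exact (K₀₂ x hx).2
          · rcases hcols j hjm with hj | hj | hj <;> rw [hj]
            · exact h3
            · exact (K₁₂ x hx).1
            · exact (K₁₂ x hx).2
  -- (5) rank–nullity for row `a`
  have himage : W.map ρ ≤ LinearMap.ker (LinearMap.proj m₁ : (Fin 4 → K) →ₗ[K] K) := by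
    rintro _ ⟨x, hx, rfl⟩
    rw [LinearMap.mem_ker, LinearMap.proj_apply, hρ]
    exact hzero x hx
  have hk3 : finrank K (LinearMap.ker (LinearMap.proj m₁ : (Fin 4 → K) →ₗ[K] K)) = 3 := by
    have hsurj : Function.Surjective (LinearMap.proj m₁ : (Fin 4 → K) →ₗ[K] K) :=
      fun t => ⟨Pi.single m₁ t, by simp⟩
    have h := LinearMap.finrank_range_add_finrank_ker (LinearMap.proj m₁ : (Fin 4 → K) →ₗ[K] K)
    rw [LinearMap.range_eq_top.2 hsurj, finrank_top, Module.finrank_self,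
      Module.finrank_fintype_fun_eq_card, Fintype.card_fin] at h
    omega
  have hle : finrank K (W.map ρ) ≤ 3 := by
    have := Submodule.finrank_mono himage; omega
  have hdim := finrank_eq_finrank_map_add_finrank_inf_ker W ρ
  rw [← hW₀] at hdim
  omega

end Summit.ValiantsHypothesis.ValiantsHypothesis.Theorems.SymPencilPerFourHessianRankThreeZero

end
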